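import Mathlib.Analysis.Convex.Contractible
import Literature.AlgebraicGeometry.Motives.AffineAlgebraicDeRhamPoincareProofs
import Literature.AlgebraicTopology.SingularHomology.CohomologyHomotopyInvariance
import Literature.AlgebraicTopology.SingularHomology.CohomologyClopenPieces
import HarnessLib

/-!
# Grothendieck's comparison theorem for affine space and for the empty scheme

Topic `Literature/AlgebraicGeometry/Motives`; a sibling of `AffineAlgebraicDeRham`, whose named fact
`AffineAlgebraicDeRham` [Grothendieck1966, Thm 1] asserts, for every ideal `I ⊆ ℂ[x₁, …, xₙ]` with
smooth quotient and every `p`, a `ℂ`-linear isomorphism between the algebraic de Rham cohomology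
`AffineDeRham.DeRhamCohomology I p` of `X = V(I)` and the singular cohomology
`singularCohomology ℂ ℂ X(ℂ) p` of its space of complex points.

This file proves the two instances of that statement which the present tree can reach, as honest
theorems (partial progress on the fact; the general case needs resolution of singularities, GAGA
and the Atiyah–Hodge lemma, none of which is available):

* `AffineAlgebraicDeRham.affineSpace` — the case `I = ⊥`, `X = 𝔸ⁿ_ℂ`: by the algebraic Poincaré
  lemma (`AffineAlgebraicDeRhamPoincareProofs`, [Hartshorne1975, Ch. II Prop. 7.1]) the de Rham
  side is `H⁰_dR(𝔸ⁿ) = ℂ`, `H^{p+1}_dR(𝔸ⁿ) = 0` [Hartshorne1975, Ch. II §7, p. 53]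
  (`deRhamCohomologyBotZeroEquiv`, `subsingleton_deRhamCohomology_bot_succ`, over any commutative
  ring `k ⊇ ℚ`); the Betti side is the cohomology of the contractible space `ℂⁿ`
  (`singularCohomology.isoOfContractible`, `singularCohomologyZeroEquiv`, Hatcher §3.1);
* `AffineAlgebraicDeRham.top` — the case `I = ⊤`, `X = ∅`: both sides vanish
  (`subsingleton_deRhamCohomology_top`, `isZero_singularCohomology_of_isEmpty`);
* `AffineDeRham.subsingleton_deRhamCohomology_of_lt` — for every `I` and every commutative ring
  `k`, `H^p_dR(V(I)/k) = 0` for `p > n` (no `p`-forms on `𝔸ⁿ`), the de Rham side of the fact above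
  the dimension of the ambient space.

Everything is proved; no named facts are introduced (D-0026). The fact `AffineAlgebraicDeRham`
itself (all smooth `V(I)`) is NOT proved here.

## References

* [Grothendieck1966] A. Grothendieck, *On the de Rham cohomology of algebraic varieties*,
  Publ. Math. IHÉS 29 (1966) 95–103, Thm 1 (p. 95).
* [Hartshorne1975] R. Hartshorne, *On the de Rham cohomology of algebraic varieties*, Publ. Math.
  IHÉS 45 (1975), Ch. II §7, p. 53 and Prop. (7.1).
* [HatcherAT2002] A. Hatcher, *Algebraic Topology*, CUP 2002, §3.1 pp. 199–201.
-/

noncomputable section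

open MvPolynomial CategoryTheory CategoryTheory.Limits

namespace Literature.AlgebraicGeometry.Motives

namespace AffineDeRham

variable {k : Type*} [CommRing k] {n p : ℕ}

/-! ### The algebraic de Rham cohomology of affine space -/

variable (k n) in
/-- The restriction of constants to `𝔸ⁿ`: `c ↦` the class of the `0`-form `c`, a `k`-linear map
`k → Ω⁰_{A/k}` for `A = k[x]/⊥`. [folklore] -/
def constRegularForm : k →ₗ[k] RegularForm (⊥ : Ideal (MvPolynomial (Fin n) k)) 0 :=
  ((RegularForm.mk (⊥ : Ideal (MvPolynomial (Fin n) k)) (p := 0)).restrictScalars k) ∘ₗ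
    ((ofPoly (k := k) (n := n)).toLinearMap.restrictScalars k) ∘ₗ
      Algebra.linearMap k (MvPolynomial (Fin n) k)

/-- `constRegularForm k n c` is the restriction of the `0`-form `C c`. [folklore] -/
@[simp]
theorem constRegularForm_apply (c : k) :
    constRegularForm k n c = RegularForm.mk ⊥ (ofPoly (C c)) :=
  rfl

/-- Constants are closed `0`-forms on `𝔸ⁿ`. [folklore] -/
theorem constRegularForm_mem_closedForms (c : k) :
    constRegularForm k n c ∈ closedForms (⊥ : Ideal (MvPolynomial (Fin n) k)) 0 := by
  rw [constRegularForm_apply, mk_mem_closedForms_iff, IsClosedOn, extDeriv_ofPoly_C]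
  exact Submodule.zero_mem _

section RatAlgebra

variable [Algebra ℚ k]

/-- On affine space (`I = ⊥`) a polynomial form of positive degree closed on `X = 𝔸ⁿ` is exact on
`X` (the Poincaré lemma `exists_extDeriv_eq`). [cite: Hartshorne1975, Ch. II Prop. 7.1] -/
theorem isExactOn_bot_of_isClosedOn {ω : PolyForm k n (p + 1)}
    (h : IsClosedOn (⊥ : Ideal (MvPolynomial (Fin n) k)) ω) :
    IsExactOn (⊥ : Ideal (MvPolynomial (Fin n) k)) ω := by
  rw [IsClosedOn, vanishingForms_bot, Submodule.mem_bot] at h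
  obtain ⟨η, hη⟩ := exists_extDeriv_eq ω h
  refine ⟨η, ?_⟩
  rw [hη, sub_self]
  exact Submodule.zero_mem _

variable (k) in
/-- **`H^{p+1}_dR(𝔸ⁿ_k) = 0`** for `k ⊇ ℚ` [Hartshorne1975, Ch. II §7, p. 53: for `Y = 𝔸ⁿ`,
`H⁰(Y) = k` "and all other cohomology … groups are zero"]. [cite: Hartshorne1975, Ch. II §7 p. 53] -/
theorem subsingleton_deRhamCohomology_bot_succ (n p : ℕ) :
    Subsingleton (DeRhamCohomology (⊥ : Ideal (MvPolynomial (Fin n) k)) (p + 1)) := by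
  refine subsingleton_of_forall_eq 0 fun x => ?_
  obtain ⟨⟨c, hc⟩, rfl⟩ := DeRhamCohomology.mk_surjective _ x
  obtain ⟨ω, rfl⟩ := RegularForm.mk_surjective _ c
  rw [DeRhamCohomology.mk_eq_zero_iff, mk_mem_exactForms_iff]
  exact isExactOn_bot_of_isClosedOn ((mk_mem_closedForms_iff _ ω).mp hc)

variable (k n) in
/-- **The closed `0`-forms on `𝔸ⁿ_k` are the constants** (`k ⊇ ℚ`): the `k`-linear isomorphism
`k ≃ Z⁰(𝔸ⁿ)`, `c ↦ c` (injective as no non-zero form vanishes on `𝔸ⁿ`, surjective by the degree-`0`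
Poincaré lemma `eq_C_of_extDeriv_ofPoly_eq_zero`). [cite: Hartshorne1975, Ch. II Prop. 7.1] -/
def closedFormsBotZeroEquiv : k ≃ₗ[k] closedForms (⊥ : Ideal (MvPolynomial (Fin n) k)) 0 :=
  LinearEquiv.ofBijective
    ((constRegularForm k n).codRestrict _ constRegularForm_mem_closedForms)
    ⟨by
      refine (injective_iff_map_eq_zero _).mpr fun c hc => ?_
      have h : RegularForm.mk ⊥ (ofPoly (C c)) = 0 := congrArg Subtype.val hc
      rw [RegularForm.mk_eq_zero_iff, ofPoly_mem_vanishingForms_iff, Ideal.mem_bot, C_eq_zero] at h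
      exact h,
     by
      rintro ⟨x, hx⟩
      obtain ⟨ω, rfl⟩ := RegularForm.mk_surjective _ x
      obtain ⟨f, rfl⟩ := (ofPoly (k := k) (n := n)).surjective ω
      have hf : extDeriv (ofPoly f) = 0 := by
        rw [mk_mem_closedForms_iff, IsClosedOn, vanishingForms_bot, Submodule.mem_bot] at hx
        exact hx
      obtain ⟨c, rfl⟩ : ∃ c : k, C c = f := ⟨coeff 0 f, (eq_C_of_extDeriv_ofPoly_eq_zero f hf).symm⟩
      exact ⟨c, rfl⟩⟩

variable (k n) in
/-- **`H⁰_dR(𝔸ⁿ_k) ≅ k`** for `k ⊇ ℚ` [Hartshorne1975, Ch. II §7, p. 53]: `H⁰ = Z⁰` (no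
coboundaries in degree `0`) and `Z⁰ = k`. [cite: Hartshorne1975, Ch. II §7 p. 53] -/
def deRhamCohomologyBotZeroEquiv : DeRhamCohomology (⊥ : Ideal (MvPolynomial (Fin n) k)) 0 ≃ₗ[k] k :=
  (Submodule.quotEquivOfEqBot _ (by
    change ((⊥ : Submodule k _).comap (closedForms (⊥ : Ideal (MvPolynomial (Fin n) k)) 0).subtype)
      = ⊥
    rw [Submodule.comap_bot, Submodule.ker_subtype]) :
      DeRhamCohomology (⊥ : Ideal (MvPolynomial (Fin n) k)) 0 ≃ₗ[k]
        closedForms (⊥ : Ideal (MvPolynomial (Fin n) k)) 0).trans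
    (closedFormsBotZeroEquiv k n).symm

end RatAlgebra

/-! ### The empty scheme -/

/-- Every form vanishes on the empty subscheme `V(⊤) = ∅`. [folklore] -/
theorem vanishingForms_top (p : ℕ) : vanishingForms (⊤ : Ideal (MvPolynomial (Fin n) k)) p = ⊤ :=
  eq_top_iff.mpr ((Submodule.top_smul ⊤).ge.trans (smul_top_le_vanishingForms ⊤ p))

/-- There are no non-zero regular forms on the empty scheme. [folklore] -/
theorem subsingleton_regularForm_top (p : ℕ) :
    Subsingleton (RegularForm (⊤ : Ideal (MvPolynomial (Fin n) k)) p) :=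
  Submodule.Quotient.subsingleton_iff.mpr (vanishingForms_top p)

variable (k) in
/-- **`H^p_dR(∅) = 0`**: the de Rham cohomology of the empty subscheme `V(⊤)` of `𝔸ⁿ_k` vanishes.
[folklore] -/
theorem subsingleton_deRhamCohomology_top (n p : ℕ) :
    Subsingleton (DeRhamCohomology (⊤ : Ideal (MvPolynomial (Fin n) k)) p) := by
  haveI := subsingleton_regularForm_top (k := k) (n := n) p
  refine subsingleton_of_forall_eq 0 fun x => ?_
  obtain ⟨c, rfl⟩ := DeRhamCohomology.mk_surjective _ x
  rw [Subsingleton.elim c 0, map_zero]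

/-! ### Vanishing above the dimension of the ambient affine space -/

/-- There are no non-zero polynomial `p`-forms on `𝔸ⁿ` for `p > n`: an alternating map on the
rank-`n` lattice `ℤⁿ` in more than `n` arguments vanishes (on tuples of basis vectors two arguments
coincide; `Module.Basis.ext_alternating`). [folklore] -/
theorem subsingleton_polyForm_of_lt (h : n < p) : Subsingleton (PolyForm k n p) := by
  refine ⟨fun ω₁ ω₂ => (Pi.basisFun ℤ (Fin n)).ext_alternating fun v hv => ?_⟩
  exact absurd (Fintype.card_le_of_injective v hv) (by simpa using h)

/-- Hence there are no non-zero regular `p`-forms on `V(I) ⊆ 𝔸ⁿ` for `p > n`. [folklore] -/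
theorem subsingleton_regularForm_of_lt (I : Ideal (MvPolynomial (Fin n) k)) (h : n < p) :
    Subsingleton (RegularForm I p) := by
  haveI := subsingleton_polyForm_of_lt (k := k) h
  exact (RegularForm.mk_surjective I (p := p)).subsingleton

/-- **`H^p_dR(V(I)/k) = 0` for `p > n`**, for every ideal `I ⊆ k[x₁, …, xₙ]` and every commutative
ring `k` (there are no forms of degree `> n` on `𝔸ⁿ`). [folklore] -/
theorem subsingleton_deRhamCohomology_of_lt (I : Ideal (MvPolynomial (Fin n) k)) (h : n < p) :
    Subsingleton (DeRhamCohomology I p) := by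
  haveI := subsingleton_regularForm_of_lt I h
  refine subsingleton_of_forall_eq 0 fun x => ?_
  obtain ⟨c, rfl⟩ := DeRhamCohomology.mk_surjective _ x
  rw [Subsingleton.elim c 0, map_zero]

/-! ### The complex points of `𝔸ⁿ` and of `∅` -/

/-- `V(0) = ℂⁿ`. [folklore] -/
theorem zeroLocus_bot : MvPolynomial.zeroLocus ℂ (⊥ : Ideal (MvPolynomial (Fin n) ℂ)) = Set.univ := by
  ext x
  simp

/-- `V(1) = ∅`. [folklore] -/
theorem zeroLocus_top : MvPolynomial.zeroLocus ℂ (⊤ : Ideal (MvPolynomial (Fin n) ℂ)) = ∅ := by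
  ext x
  simp only [mem_zeroLocus_iff, Submodule.mem_top, forall_const, Set.mem_empty_iff_false,
    iff_false, not_forall]
  exact ⟨1, by simp⟩

/-- `ℂⁿ = V(0)` (with its analytic topology) is contractible. [folklore] -/
theorem contractibleSpace_zeroLocus_bot :
    ContractibleSpace ↥(MvPolynomial.zeroLocus ℂ (⊥ : Ideal (MvPolynomial (Fin n) ℂ))) := by
  rw [zeroLocus_bot]
  exact (Homeomorph.Set.univ (Fin n → ℂ)).contractibleSpace_iff.mpr inferInstance

/-- `V(1) = ∅` has no points. [folklore] -/
theorem isEmpty_zeroLocus_top :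
    IsEmpty ↥(MvPolynomial.zeroLocus ℂ (⊤ : Ideal (MvPolynomial (Fin n) ℂ))) := by
  rw [zeroLocus_top]
  infer_instance

end AffineDeRham

/-! ### The comparison for `𝔸ⁿ` and for `∅` -/

namespace AffineAlgebraicDeRham

open AffineDeRham Literature.AlgebraicTopology.SingularHomology

/-- **Grothendieck's comparison theorem for affine space** (the case `I = ⊥` of
`AffineAlgebraicDeRham`, proved): for every `n` and `p`, `H^p_dR(𝔸ⁿ_ℂ/ℂ) ≅ H^p(ℂⁿ; ℂ)` as
`ℂ`-vector spaces — both are `ℂ` for `p = 0` (algebraic Poincaré lemma in degree `0`;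
`H⁰` of the path-connected space `ℂⁿ`) and `0` for `p > 0` (algebraic Poincaré lemma; `ℂⁿ` is
contractible). [Grothendieck1966, Thm 1; Hartshorne1975, Ch. II §7 p. 53; Hatcher §3.1 p. 199–201.]
[cite: Grothendieck1966, Thm 1] -/
theorem affineSpace (n p : ℕ) :
    Nonempty (DeRhamCohomology (⊥ : Ideal (MvPolynomial (Fin n) ℂ)) p ≃ₗ[ℂ]
      singularCohomology ℂ ℂ (MvPolynomial.zeroLocus ℂ (⊥ : Ideal (MvPolynomial (Fin n) ℂ))) p) := by
  haveI := contractibleSpace_zeroLocus_bot (n := n)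
  cases p with
  | zero =>
    exact ⟨(deRhamCohomologyBotZeroEquiv ℂ n).trans (singularCohomologyZeroEquiv ℂ ℂ _).symm⟩
  | succ p =>
    haveI := subsingleton_deRhamCohomology_bot_succ ℂ n p
    haveI : Subsingleton (singularCohomology ℂ ℂ
        (MvPolynomial.zeroLocus ℂ (⊥ : Ideal (MvPolynomial (Fin n) ℂ))) (p + 1)) :=
      ModuleCat.subsingleton_of_isZero (IsZero.of_iso
        (singularCochainComplex.isZero_singularCohomology_of_subsingleton' (R := ℂ) (M := ℂ)
          (X := PUnit.{1}) (Nat.succ_ne_zero p))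
        (singularCohomology.isoOfContractible ℂ ℂ _ (p + 1)).symm)
    exact ⟨LinearEquiv.ofSubsingleton _ _⟩

/-- **Grothendieck's comparison theorem for the empty scheme** (the case `I = ⊤` of
`AffineAlgebraicDeRham`, proved): both `H^p_dR(∅)` and `H^p(∅; ℂ)` vanish.
[cite: Grothendieck1966, Thm 1] -/
theorem top (n p : ℕ) :
    Nonempty (DeRhamCohomology (⊤ : Ideal (MvPolynomial (Fin n) ℂ)) p ≃ₗ[ℂ]
      singularCohomology ℂ ℂ (MvPolynomial.zeroLocus ℂ (⊤ : Ideal (MvPolynomial (Fin n) ℂ))) p) := by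
  haveI := subsingleton_deRhamCohomology_top ℂ n p
  haveI := isEmpty_zeroLocus_top (n := n)
  haveI : Subsingleton (singularCohomology ℂ ℂ
      (MvPolynomial.zeroLocus ℂ (⊤ : Ideal (MvPolynomial (Fin n) ℂ))) p) :=
    ModuleCat.subsingleton_of_isZero (isZero_singularCohomology_of_isEmpty p)
  exact ⟨LinearEquiv.ofSubsingleton _ _⟩

/-- The two proved instances packaged in the shape of the fact: `AffineAlgebraicDeRham` holds for
the ideals `⊥` and `⊤` of `ℂ[x₁, …, xₙ]` (with or without the smoothness hypothesis, which both
satisfy). [cite: Grothendieck1966, Thm 1] -/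
theorem of_eq_bot_or_eq_top {n : ℕ} {I : Ideal (MvPolynomial (Fin n) ℂ)} (hI : I = ⊥ ∨ I = ⊤)
    (p : ℕ) :
    Nonempty (DeRhamCohomology I p ≃ₗ[ℂ]
      singularCohomology ℂ ℂ (MvPolynomial.zeroLocus ℂ I) p) := by
  rcases hI with rfl | rfl
  · exact affineSpace n p
  · exact top n p

end AffineAlgebraicDeRham

end Literature.AlgebraicGeometry.Motives

end
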